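import Summits.CriticalPhenomena.SAWScalingLimit.Theorems.SAWTotalPositivityCriticalBubbleBoundDockingReduction
import Summits.CriticalPhenomena.SAWScalingLimit.Theorems.SAWTotalPositivityCriticalBubbleBoundJoinMassBootstrap
import Summits.CriticalPhenomena.SAWScalingLimit.Theorems.SAWTotalPositivityCriticalBubbleBoundJoinMacroDoor
import Summits.CriticalPhenomena.SAWScalingLimit.Theorems.SAWTotalPositivityCriticalBubbleBoundJoinBigEntropy
import Summits.CriticalPhenomena.SAWScalingLimit.Theorems.SAWTotalPositivityCriticalBubbleBoundJoinBigFloorHalf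
import Summits.CriticalPhenomena.SAWScalingLimit.Theorems.SAWTotalPositivityCriticalBubbleBoundJoinBigCeiling
import Summits.CriticalPhenomena.SAWScalingLimit.Theorems.SAWTotalPositivityCriticalBubbleBoundJoinMacroLower
import Summits.CriticalPhenomena.SAWScalingLimit.Theorems.SAWTotalPositivityCriticalBubbleBoundJoinPointwise

/-!
# Line `docking-census-joining` — skeleton for the crux `SAWTotalPositivity.CriticalBubbleBound`
(crux item stmt-CriticalPhenomena-7117, route `route-CriticalPhenomena-SAWTotalPositivity`)

LEAD'S COPY (prover-line-stmt-CriticalPhenomena-7117-c8-0, continuation seat c8 — skeleton r3 of seat c7 UNCHANGED in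
its composition; `work/CriticalBubbleBound.lean`, re-published to `Lines/docking_census_joining.lean` after every change).

STATUS (2026-08-17, c8 — consolidation cycle 1): both knobs remain OPEN research statements (no source in print gives
any size exponent `ν' > 1/2` or any macroscopic rarity gain `π > 0`). Landed this seat (all ACCEPTED, `--supports`):
`Join.bigMassFraction_of_lt_half` / `Join.bigMass_eq_blockMass_of_lt_half` (p162083: the size knob is FREE below `1/2` —
every class of a large block is big by the bounding-box count — so the two-knob door with `ν' < 1/2` is exactly the
one-stub door `π > 1/2`; the content of the size knob is the passage `1/2 → 5/8`), `Join.not_bigMassFraction_of_one_lt` +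
`Join.blockMass_jterm_pos` + `Join.cterm_pos_of_odd` (p162378: ceiling/non-vacuity — the knob FAILS above `1`, block masses
are positive from scale 5 on, thin-column witnesses), `Join.Umac_ge` / `Join.Umac_ge_of_joinEntropyAt` (p162000: the LOWER
side of the rarity knob — macroscopic global join plaquettes carry at least the join entropy, `c 2^{i/2} R'_i² ≤ Umac_i`),
`Join.join_term_le_rpow` / `Join.join_cterm_le_rpow` (p162082: the POINTWISE proved window `t_n = O(n^{1/2+ε})`,
`q_N x_c^N = O(N^{-1/2+ε})` for ALL `n` — Madras 1995's pointwise exponent as a corollary of the landed block form).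


STATUS (2026-08-17, c7 — RESHAPED r3, "the macroscopic door"): the crux is Madras–Slade's open problem
`G_{x_c}(0,e₀) < ∞` on ℤ²; the docking line's exponent ledger `θ − 1 = κ + π` (S4 `Docking.stub_ledgerBootstrap`,
landed) closes it as soon as `κ + π > 2` (`Join.criticalBubbleBound_of_ledger`, p157249). Proved inputs: ENTROPY
`κ = 3/2` (Hammond 2018 L4.11/4.12: `Join.Dent_ge` = `Join.joinEntropyAt_three_halves`, p157339); RARITY `π = 0` for
GLOBAL join plaquettes (Prop. 4.5: `Join.Urar_le_of_tail` + `Join.gjoins_tail_bound`), which is SHARP for `Urar`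
(unit-square ears: `Join.card_lexRooted_le_four_mul_sum_card_gjoins`, p159080); INJECTION into MACROSCOPIC targets
(`Join.Dent_le_Umac`, p157103: the junction flip of the Madras join returns the two partners, of `j+9` and `m+9` edges,
`Join.joinPoly_sides_card` p156633, each at least a quarter of the join). Hence the two KNOBS of this skeleton:

* SIZE knob `stub_bigMassFraction : BigMassFraction (5/8)` — a positive fraction of the critical mass of every dyadic
  block sits on classes of linear size `≥ 2^{5i/8}` (conjecturally true for every exponent `< ν = 3/4`; proved `0`,
  `Join.bigMassFraction_zero`; even `> 1/2` — non-density of critical polygons — is open); it gives join entropy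
  `κ = 1 + 5/8` (`Join.joinEntropyAt_of_bigMassFraction`, p158694);
* RARITY knob `stub_joinMacroRarity : JoinMacroRarity (1/2)` — a critical class of scale `2^{i+1}` carries on
  `x_c`-average `≲ (i+1)^b 2^{-i/2}` MACROSCOPIC global join plaquettes (heuristic `π₀ = ν(x₄ − 2) = 11/16`, margin
  `3/16`; proved `0`, `Join.joinMacroRarity_zero`);

and the composition `Join.criticalBubbleBound_of_bigMassFraction_of_joinMacroRarity` (`0 < ν'`, `1 < ν' + π`; here
`5/8 + 1/2 = 9/8`). ONE-STUB VARIANT (landed door, p157993): `Join.criticalBubbleBound_of_joinMacroRarity :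
1/2 < π → JoinMacroRarity π → CriticalBubbleBound` — e.g. `JoinMacroRarity (9/16)` alone closes the crux.
QUANTITATIVE MEANING (p158622, `Join.join_blockMass_term_le_of_joinMacroRarity`): `JoinMacroRarity π` for `π ≤ 1` gives
block-averaged `θ ≥ 3/2 + π − ε` for the crux's rooted series (`θ > 2` is the crux; `θ ≥ 3/2 − ε` is c6's landed
join-mass bootstrap = Hammond's Theorem 1.3 in block form).

INHERITED compositions (landed, still valid doors, NOT used below): crux ⇐ S2 `DockingEntropy (5/8)` ∧ S3
`PinchRarity (1/2)` (p77108, leads 0/c6); floors `dockingEntropy_zero`, `pinchRarity_neg_one`; S1 p76255; S4 p73905.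

Disproof.lean (cdisprove gen 5, §0–§26) honoured: §7/§10 normal form (via the doors); §4 fugacity load-bearing (all at `x_c`);
§16 Hammersley–Welsh a-priori bound feeds S4 (`Join.jterm_le_exp`); §24 S4's analytic hypotheses are load-bearing (used
as landed, unchanged); §17 (boundary ≠ bulk, memoryless) not engaged — the line works with the bulk rooted series;
§25 moment ladder: `JoinMacroRarity π` ⇒ block decay `s > -1/2 - π` (p158622).
NUMERICS (this seat, work/py; uniform SAP_N by two-point pivot, validated against exact enumeration N ≤ 22): E[#mjoins] =
0.0368, 0.0222, 0.0134, 0.0084 at N = 128, 256, 512, 1024 — log–log slope −0.72 ± 0.01 (prediction −11/16; the rarity knob needs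
< −1/2); E[#gjoins] = 0.32…0.34 flat (ears); E[log max(h,w)] slope 0.767 (ν = 3/4), P(max(h,w) ≥ N^{5/8}) = 0.95, 0.996, 1.00, 1.00
(size knob); production kit jobs j025818 / j025822 (N ≤ 2048) attach themselves to the item.
-/


noncomputable section

open Literature.Probability.LatticeModels
open Literature.Probability.RandomPlanarGeometry Literature.Probability.RandomPlanarGeometry.SAW
open scoped BigOperators
open Summit.CriticalPhenomena.SAWScalingLimit.Theses.SAWTotalPositivity (CriticalBubbleBound)

namespace Summit.CriticalPhenomena.SAWScalingLimit.Cruxes.CriticalBubbleBound.DockingCensusJoining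

open Summit.CriticalPhenomena.SAWScalingLimit.Theorems.CriticalBubbleBound.Docking
open Summit.CriticalPhenomena.SAWScalingLimit.Theorems.CriticalBubbleBound.Join

/-! ## Audit names of the stub statements (the tree's `@[conjecture]` obligation defs) -/

namespace Goal

/-- Statement of stub `stub_bigMassFraction` (= `Join.BigMassFraction (5/8)`, landed obligation node, p158183). -/
abbrev stub_bigMassFraction : Prop := BigMassFraction (5 / 8)

/-- Statement of stub `stub_joinMacroRarity` (= `Join.JoinMacroRarity (1/2)`, landed obligation node, p156200). -/
abbrev stub_joinMacroRarity : Prop := JoinMacroRarity (1 / 2)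

end Goal

/-! ## The two OPEN registered stubs (the knobs of the macroscopic door) -/

/-- **SIZE knob `stub_bigMassFraction`** (constructive, OPEN): for all large `i`, a fixed fraction of the critical
mass `R'_i` of the dyadic block is carried by classes with `max (height, width) ≥ 2^{5i/8}` — through Hammond's
offsets count this is join entropy `κ = 13/8`. Conjecturally true for every exponent `< ν = 3/4`; proved: `0`
(`bigMassFraction_zero`); open for every exponent `> 1/2`. -/
theorem stub_bigMassFraction : BigMassFraction (5 / 8) := by
  sorry

/-- **RARITY knob `stub_joinMacroRarity`** (restrictive, OPEN, HARDEST — the lead's stub): macroscopic global join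
plaquettes are rare with gain `π = 1/2`: `Umac i ≤ C (i+1)^b 2^{-i/2} R'_{i+1} + C 2^{-4i}`. Heuristic `π₀ = 11/16`
(four-leg exponent `x₄ = 35/12`), margin `3/16`; proved: `π = 0` (`joinMacroRarity_zero`); this is Hammond's missing
"Step C" (a four-arm / interior-contact upper bound for critical planar polygons). -/
theorem stub_joinMacroRarity : JoinMacroRarity (1 / 2) := by
  sorry

/-! ## The composition (all glue LANDED) -/

/-- **The composition**: the two knobs imply the crux BY NAME through the landed two-knob door
`Join.criticalBubbleBound_of_bigMassFraction_of_joinMacroRarity` (`0 < 5/8`, `1 < 5/8 + 1/2`), which chains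
`joinEntropyAt_of_bigMassFraction` (κ = 13/8), `Dent_le_Umac` (injection into macroscopic targets),
`criticalBubbleBound_of_ledger` (S4 at `(κ, π)` with `κ + π = 17/8 > 2`, `s ∈ (-9/8, -1)`), the block transfer to the
rooted series and the one-number normal form. -/
theorem CriticalBubbleBound_of_stubs :
    Goal.stub_bigMassFraction → Goal.stub_joinMacroRarity →
      _root_.Summit.CriticalPhenomena.SAWScalingLimit.Theses.SAWTotalPositivity.CriticalBubbleBound :=
  fun hB hM => criticalBubbleBound_of_bigMassFraction_of_joinMacroRarity (5 / 8) (1 / 2) (by norm_num) (by norm_num) hB hM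

/-- **`CriticalBubbleBound` from the line `docking-census-joining`**: sorry-free except through the two open knobs
`stub_bigMassFraction` / `stub_joinMacroRarity`. -/
theorem CriticalBubbleBound_of :
    _root_.Summit.CriticalPhenomena.SAWScalingLimit.Theses.SAWTotalPositivity.CriticalBubbleBound :=
  CriticalBubbleBound_of_stubs stub_bigMassFraction stub_joinMacroRarity

/-! ## For the record (landed doors, NOT restated here to keep the audit's deciding theorem unambiguous)
* one-stub variant (p157993): `Join.criticalBubbleBound_of_joinMacroRarity : ∀ π, 1/2 < π → JoinMacroRarity π → CriticalBubbleBound`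
  — e.g. `JoinMacroRarity (9/16)` alone closes the crux;
* parametric door (p157993): `Join.criticalBubbleBound_of_joinEntropyAt_of_joinMacroRarity` (`0 ≤ κ`, `κ + π > 2`);
* two-knob door (p158694): `Join.criticalBubbleBound_of_bigMassFraction_of_joinMacroRarity` (`0 < ν'`, `1 < ν' + π`) — used above;
* inherited door (p77108): `Docking.criticalBubbleBound_of_dockingEntropy_of_pinchRarity : DockingEntropy (5/8) → PinchRarity (1/2) → …`;
* quantitative meaning (p158622): `Join.join_blockMass_term_le_of_joinMacroRarity` (block θ ≥ 3/2 + π − ε);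
* unrestricted rarity exhausted (p159080): `Join.card_lexRooted_le_four_mul_sum_card_gjoins` (ears);
* termwise (uniform-SAP_N, length-by-length) interfaces of the two knobs (p159867 `Join.joinMacroRarity_of_termwise`,
  p159791 `Join.bigMassFraction_of_termwise`) — the form in which the numerics measure them. -/

/-- The proved floors of the two knobs and of the entropy: `ν' = 0`, `π = 0`, `κ = 3/2` (p158183, p157339). -/
theorem landed_floors : BigMassFraction 0 ∧ JoinMacroRarity 0 ∧ JoinEntropyAt (3 / 2) :=
  ⟨bigMassFraction_zero, joinMacroRarity_zero, joinEntropyAt_three_halves⟩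

/-- c8: the proved WINDOW of the size knob — free below `1/2` (bounding box), false above `1` (no class of block `i`
has linear size `≥ 2^{i+2}`, and block masses are positive); the knob's content is `(1/2, 5/8]` (p162083, p162378). -/
theorem landed_size_window :
    (∀ ν' : ℝ, ν' < 1 / 2 → BigMassFraction ν') ∧ (∀ ν' : ℝ, 1 < ν' → ¬ BigMassFraction ν') :=
  ⟨bigMassFraction_of_lt_half, not_bigMassFraction_of_one_lt⟩

/-- c8: the proved LOWER side of the rarity knob — macroscopic global join plaquettes carry at least Hammond's
entropy: `c 2^{i/2} (R'_i)² ≤ Umac_i` for large `i` (p162000); the knob asks for the UPPER bound `2^{-i/2} R'_{i+1}`. -/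
theorem landed_rarity_lower : ∃ c : ℝ, 0 < c ∧ ∃ i₀ : ℕ, ∀ i : ℕ, i₀ ≤ i →
    c * (2 : ℝ) ^ ((1 / 2 : ℝ) * (i : ℝ)) * blockMass jterm i ^ 2 ≤ Umac i :=
  Umac_ge

/-- c8: the POINTWISE proved window for the crux's own terms, `t_n = c_n(0,e₀) x_c^n = O(n^{s})` for every
`s > 1/2` and ALL `n` (p162082; the crux asks `Σ_n t_n < ∞`, conjecturally `t_n ≍ n^{-3/2}`). -/
theorem landed_pointwise_window : ∀ s : ℝ, (1 : ℝ) / 2 < s → ∃ C : ℝ, ∀ n : ℕ,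
    term n ≤ C * ((n : ℝ) + 1) ^ s :=
  join_term_le_rpow

/-- c6's join-mass bootstrap in crux currency (p153678): block-averaged `θ ≥ 3/2 − ε` unconditionally. -/
theorem landed_blockMass_term_le : ∀ s : ℝ, (1 : ℝ) / 2 < s → ∃ C : ℝ, ∀ i : ℕ,
    blockMass term i ≤ C * (2 : ℝ) ^ (s * (i : ℝ)) :=
  join_blockMass_term_le

/-! ## c8: headline TERMWISE reductions (uniform-`SAP_N` language) — landed separately as
`Theorems/SAWTotalPositivityCriticalBubbleBoundJoinTermwiseDoor.lean` (`Join.criticalBubbleBound_of_termwise_rarity`,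
`Join.criticalBubbleBound_of_termwise_size_rarity`), not restated here so that the audit's deciding theorem stays unambiguous. -/

end Summit.CriticalPhenomena.SAWScalingLimit.Cruxes.CriticalBubbleBound.DockingCensusJoining

end
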